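import Literature.Geometry.Lorentzian.GaussEquationFrame
import Literature.Geometry.Lorentzian.GradientSection
import Literature.Geometry.Lorentzian.EinsteinProofs
import HarnessLib

/-!
# The Hessian and Laplacian of a function restricted to an immersed hypersurface

For a spacelike immersion `f : (N, f^*g) → (M, g)` of a hypersurface with unit normal `ν` of sign
`ε` and second fundamental form `K(v, w) = g(D_v ν, df w)`, and a `C²` function `φ` on `M`, the
Hessian of the restriction `φ ∘ f` is the restriction of the ambient Hessian corrected by the
second fundamental form: `Hess_{f^*g}(φ ∘ f)(v, w) = Hess_g φ(df v, df w) − (dφ(ν)/ε) K(v, w)`,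
and hence `Δ_{f^*g}(φ ∘ f) = tr_{f^*g} (Hess_g φ ∘ (df × df)) − (dφ(ν)/ε) H` (O'Neill 1983, Ch. 4,
Lemma 3, Cor. 2 (5) and Lemma 4: `D̄_V W = D_V W + II(V, W)`, `II(v, w) = −ε K(v, w) ν`, applied to
`V(Wφ)`). This is the identity behind the maximum-principle arguments of Schoen–Yau 1979, §2,
Step 2 ((2.4): `|y|²` restricted to a minimal surface is subharmonic where `Hess |y|²` is convex;
(2.5)–(2.7): the height bound via `x³`) and the gradient bound (2.12).

* `PseudoRiemannianMetric.val_leviCivita_grad_eq_hessian` — `g(∇_A grad φ, B) = Hess φ(A, B)`.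
* `PseudoRiemannianMetric.hessian_comp_apply_localFrame` — the restricted Hessian on a coordinate
  pair of the chart at the point; `PseudoRiemannianMetric.hessian_comp_apply` — on all tangent
  vectors; `PseudoRiemannianMetric.dalembertian_comp_eq` — the restricted Laplacian
  `Δ_{f^*g}(φ ∘ f) = tr_{f^*g}(Hess_g φ ∘ (df × df)) − (dφ(ν)/ε) H`.

Everything is proved; no definitions, no named facts.

## References

* B. O'Neill, *Semi-Riemannian geometry*, Academic Press 1983, Ch. 3, Def. 3.48–Lemma 3.49
  (Hessian), Ch. 4, Lemma 1, Cor. 2, Lemma 3, Lemma 4 (Gauss formula, shape tensor).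
  [ONeill1983]
* R. Schoen, S.-T. Yau, Comm. Math. Phys. 65 (1979) 45–76, §2, (2.4)–(2.7), (2.12).
  [SchoenYauPMT1979]
-/

noncomputable section

open Bundle Set Filter Function Manifold FiberBundle
open scoped Manifold ContDiff Topology

namespace Literature.Geometry.Lorentzian

namespace PseudoRiemannianMetric

variable {E : Type*} [NormedAddCommGroup E] [NormedSpace ℝ E] {H : Type*} [TopologicalSpace H]
  {I : ModelWithCorners ℝ E H} {M : Type*} [TopologicalSpace M] [ChartedSpace H M]
  [IsManifold I ∞ M] [FiniteDimensional ℝ E] [CompleteSpace E] [I.Boundaryless]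
  (g : PseudoRiemannianMetric I ∞ E (TangentSpace I : M → Type _)) [g.HasLeviCivita]

/-- **`g(∇_A grad φ, B) = Hess φ(A, B)`** for a `C²` function `φ` (O'Neill 1983, Ch. 3, Def. 3.48:
`H^φ = ∇(∇φ)`, Lemma 3.49 `H^φ(X,Y) = XYφ − (∇_X Y)φ = ⟨∇_X(grad φ), Y⟩`): extend `A, B` to smooth
fields, `hessian_apply`, the metric expression `Yφ = ⟨grad φ, Y⟩` and compatibility of the
Levi-Civita connection. [cite: ONeill1983, Ch. 3, Lemma 3.49] -/
theorem val_leviCivita_grad_eq_hessian {φ : M → ℝ} {x : M} (hφ : CMDiffAt 2 φ x)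
    (A B : TangentSpace I x) :
    g.val x (g.leviCivita (fun y ↦ (g.sharp y (mvfderiv I φ y).toLinearMap : TangentSpace I y)) x A)
        B = g.hessian φ x A B := by
  set Gφ : Π y : M, TangentSpace I y := fun y ↦ g.sharp y (mvfderiv I φ y).toLinearMap with hGφ
  set XA : Π y : M, TangentSpace I y := FiberBundle.extend E A with hXA
  set YB : Π y : M, TangentSpace I y := FiberBundle.extend E B with hYB
  have hXA0 : XA x = A := extend_apply_self (F := E) A
  have hYB0 : YB x = B := extend_apply_self (F := E) B
  have hXAs : MDiffAt (T% XA) x :=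
    (contMDiffAt_extend (I := I) (F := E) (V := (TangentSpace I : M → Type _)) (k := 1)
      A).mdifferentiableAt one_ne_zero
  have hYBs : MDiffAt (T% YB) x :=
    (contMDiffAt_extend (I := I) (F := E) (V := (TangentSpace I : M → Type _)) (k := 1)
      B).mdifferentiableAt one_ne_zero
  have hG : MDiffAt (T% Gφ) x := g.mdifferentiableAt_sharp_mvfderiv hφ
  have hcompat := (isLeviCivita_leviCivita_holds (g := g)).2
  -- `Hess φ(A, B) = X_A(Y_B φ) − (∇_{X_A} Y_B) φ`
  have hhess := hessian_apply_holds (g := g) (x := x) (f := φ) hφ hXAs hYBs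
  rw [hXA0, hYB0] at hhess
  rw [hhess, hessianAux]
  -- `Y_B φ = g(grad φ, Y_B)` pointwise
  have hfun : (fun y ↦ mvfderiv I φ y (YB y)) = fun y ↦ g.val y (Gφ y) (YB y) := by
    funext y
    rw [hGφ, val_sharp_apply]
    rfl
  rw [hfun, hcompat hXAs hG hYBs, hXA0, hYB0, val_sharp_apply]
  simp


/-! ### The restricted Hessian on a coordinate pair -/

section Restricted

variable {E' : Type*} [NormedAddCommGroup E'] [NormedSpace ℝ E'] {H' : Type*} [TopologicalSpace H']
  {I' : ModelWithCorners ℝ E' H'} {N : Type*} [TopologicalSpace N] [ChartedSpace H' N]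
  [IsManifold I' ∞ N] [FiniteDimensional ℝ E'] [CompleteSpace E'] [I'.Boundaryless] {f : N → M}
  (hpb : PseudoRiemannianMetric.contMDiff_pullbackBilin I M I' N ∞)
  (hfi : g.IsSpacelikeImmersion I' f) {ν : NormalField I f} {ε : ℝ}
  {ι : Type*} [Fintype ι] [DecidableEq ι] (b' : Module.Basis ι ℝ E') {y₀ : N}

set_option maxHeartbeats 1600000 in
/-- **The Hessian of a restricted function on a coordinate pair** (O'Neill 1983, Ch. 4, Lemma 3,
Cor. 2 (5), Lemma 4; the computation behind Schoen–Yau 1979, (2.4)–(2.5)). For a spacelike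
immersion `f : (N, f^*g) → (M, g)` of a hypersurface (`dim M = dim N + 1`) with unit normal field
`ν` of sign `ε ≠ 0` (smooth lift), a function `φ ∈ C²(M)`, a point `y₀` and the coordinate frame
`∂ₐ` of the chart of `N` at `y₀`:
`Hess_{f^*g}(φ ∘ f)(∂ₐ, ∂_c)(y₀) = Hess_g φ(df ∂ₐ, df ∂_c)(f y₀) − (dφ(ν)/ε) K(∂ₐ, ∂_c)(y₀)`.
Proof: `Hess(φ∘f)(∂ₐ,∂_c) = ∂ₐ(∂_c(φ∘f)) − d(φ∘f)(∇_{∂ₐ}∂_c)` (`hessian_apply`);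
`∂_c(φ∘f) = g(grad φ ∘ f, df ∂_c)`, differentiated along the `a`-th coordinate line by metric
compatibility (`hasDerivAt_val_apply_along`): `g(D(grad φ ∘ f), df ∂_c) = Hess φ(df ∂ₐ, df ∂_c)`
(`val_leviCivita_grad_eq_hessian`) and `g(grad φ, D̄ₐ(df ∂_c))`, which the tangent–normal
decomposition (`val_eq_inducedMetric_add_normal`) splits into `d(φ∘f)(∇_{∂ₐ}∂_c)` (Gauss formula,
tangential part) and `dφ(ν) · (−K(∂ₐ, ∂_c))/ε` (`val_covariantDerivAlong_mfderiv_localFrame_normal₀`).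
[cite: ONeill1983, Ch. 4, Lemma 3 and Lemma 4] -/
theorem hessian_comp_apply_localFrame
    (hν : ContMDiff I' I.tangent ∞ (fun x ↦ (TotalSpace.mk' E (f x) (ν x) : TangentBundle I M)))
    (hun : g.IsUnitNormal I' f ν ε) (hε : ε ≠ 0)
    (hdim : Module.finrank ℝ E = Module.finrank ℝ E' + 1)
    {φ : M → ℝ} (hφ : CMDiff 2 φ) (a c : ι) :
    haveI := (g.inducedMetric f hpb hfi).hasLeviCivita
    (g.inducedMetric f hpb hfi).hessian (fun y ↦ φ (f y)) y₀
        ((trivializationAt E' (TangentSpace I') y₀).localFrame b' a y₀)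
        ((trivializationAt E' (TangentSpace I') y₀).localFrame b' c y₀) =
      g.hessian φ (f y₀)
          (mfderiv I' I f y₀ ((trivializationAt E' (TangentSpace I') y₀).localFrame b' a y₀))
          (mfderiv I' I f y₀ ((trivializationAt E' (TangentSpace I') y₀).localFrame b' c y₀)) -
        mvfderiv I φ (f y₀) (ν y₀) / ε *
          g.secondFundamentalForm I' f ν y₀
            ((trivializationAt E' (TangentSpace I') y₀).localFrame b' a y₀)
            ((trivializationAt E' (TangentSpace I') y₀).localFrame b' c y₀) := by
  haveI := (g.inducedMetric f hpb hfi).hasLeviCivita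
  set gN := g.inducedMetric f hpb hfi with hgN
  set e' := trivializationAt E' (TangentSpace I' : N → Type _) y₀ with he'
  set Gφ : Π x : M, TangentSpace I x := fun x ↦ g.sharp x (mvfderiv I φ x).toLinearMap with hGφ
  -- regularity
  have hf : ContMDiff I' I ∞ f := PseudoRiemannianMetric.IsSpacelikeImmersion.contMDiff_self hfi
  have hf2 : ContMDiff I' I 2 f := hf.of_le (by exact WithTop.coe_le_coe.2 le_top)
  have hfd : ∀ z, MDifferentiableAt I' I f z := hf2.mdifferentiable two_ne_zero
  have hφd : ∀ x, MDifferentiableAt I 𝓘(ℝ, ℝ) φ x := hφ.mdifferentiable two_ne_zero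
  have hcompatM := (PseudoRiemannianMetric.isLeviCivita_leviCivita_holds (g := g)).2
  have hI'1 : IsManifold I' (1 + 1) N := inferInstanceAs (IsManifold I' 2 N)
  have hVB1 : ContMDiffVectorBundle 1 E' (TangentSpace I' : N → Type _) I' :=
    TangentBundle.contMDiffVectorBundle
  have hy₀ : y₀ ∈ (chartAt H' y₀).source := mem_chart_source H' y₀
  have hy₀e : y₀ ∈ e'.baseSet := FiberBundle.mem_baseSet_trivializationAt' y₀
  have hz : extChartAt I' y₀ y₀ ∈ (extChartAt I' y₀).target := mem_extChartAt_target y₀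
  -- the `a`-th coordinate line `ℓ` through `y₀` and its base point `Q = y₀`
  set ℓ : ℝ → E' := fun t ↦ extChartAt I' y₀ y₀ + t • b' a with hℓdef
  have hℓ0 : ℓ 0 = extChartAt I' y₀ y₀ := by simp [hℓdef]
  have hℓ0t : ℓ 0 ∈ (extChartAt I' y₀).target := by rw [hℓ0]; exact hz
  have hℓaff : ∀ t, ℓ t = ℓ 0 + t • b' a := fun t ↦ by simp [hℓdef]
  have hℓ : HasDerivAt ℓ (b' a) 0 := by
    simpa [hℓdef] using ((hasDerivAt_id (0 : ℝ)).smul_const (b' a)).const_add (extChartAt I' y₀ y₀)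
  have hQ : (extChartAt I' y₀).symm (ℓ 0) = y₀ := by rw [hℓ0]; exact extChartAt_to_inv y₀
  set γN : ℝ → N := fun t ↦ (extChartAt I' y₀).symm (ℓ t) with hγN
  have hγN0 : γN 0 = y₀ := hQ
  have hγNs : ContMDiffAt 𝓘(ℝ, ℝ) I' ∞ γN 0 := by
    have := contMDiffAt_chartLine (I' := I') hz (b' a)
    simpa [hγN, hℓdef] using this
  have hγNd : MDifferentiableAt 𝓘(ℝ, ℝ) I' γN 0 := hγNs.mdifferentiableAt (by simp)
  have hvelN : velocity I' γN 0 = e'.localFrame b' a y₀ := by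
    have h1 := velocity_symm_comp₀ (I' := I') b' hℓ0t hℓ
    rw [hQ, sum_coord_basis_smul] at h1
    exact h1
  -- frame fields
  have hframe : ∀ d, MDiffAt (T% (e'.localFrame b' d)) y₀ := fun d ↦
    (contMDiffAt_localFrame_of_mem 1 e' b' d hy₀e).mdifferentiableAt one_ne_zero
  -- (1) `Hess(φ∘f)(∂ₐ, ∂_c)(y₀) = ∂ₐ(∂_c(φ∘f))(y₀) − d(φ∘f)(∇_{∂ₐ}∂_c)(y₀)`
  have hφf2 : CMDiffAt 2 (fun y ↦ φ (f y)) y₀ := (hφ (f y₀)).comp y₀ (hf2 y₀)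
  have hhessN := hessian_apply_holds (g := gN) (x := y₀) (f := fun y ↦ φ (f y)) hφf2
    (hframe a) (hframe c)
  rw [hhessN, hessianAux]
  -- (2) `∂_c(φ∘f) = g(grad φ ∘ f, df ∂_c)` pointwise
  have hchain : ∀ y (v : TangentSpace I' y), mvfderiv I' (fun y ↦ φ (f y)) y v =
      mvfderiv I φ (f y) (mfderiv I' I f y v) := by
    intro y v
    simp only [mvfderiv, ContinuousLinearMap.comp_apply]
    rw [show (fun y ↦ φ (f y)) = φ ∘ f from rfl, mfderiv_comp y (hφd (f y)) (hfd y)]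
    rfl
  have hfunc : (fun y ↦ mvfderiv I' (fun y ↦ φ (f y)) y (e'.localFrame b' c y)) =
      fun y ↦ g.val (f y) (Gφ (f y)) (mfderiv I' I f y (e'.localFrame b' c y)) := by
    funext y
    rw [hchain, hGφ, val_sharp_apply]
    rfl
  rw [hfunc]
  -- (3) derivative along the coordinate line
  set u : ℝ → ℝ := fun t ↦ g.val (f (γN t)) (Gφ (f (γN t)))
    (mfderiv I' I f (γN t) (e'.localFrame b' c (γN t))) with hu
  have hGlift : MDifferentiableAt 𝓘(ℝ, ℝ) I.tangent
      (fun t ↦ (TotalSpace.mk' E (f (γN t)) (Gφ (f (γN t))) : TangentBundle I M)) 0 := by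
    have h1 : MDiffAt (T% Gφ) (f (γN 0)) := g.mdifferentiableAt_sharp_mvfderiv (hφ (f (γN 0)))
    exact h1.comp 0 ((hfd (γN 0)).comp 0 hγNd)
  have hVlift : MDifferentiableAt 𝓘(ℝ, ℝ) I.tangent
      (fun t ↦ (TotalSpace.mk' E (f (γN t)) (mfderiv I' I f (γN t) (e'.localFrame b' c (γN t))) :
        TangentBundle I M)) 0 := by
    have h1 := mdifferentiableAt_lift_mfderiv (I := I) (I' := I') hf2
      (W := e'.localFrame b' c) (z₀ := γN 0) (by rw [hγN0]; exact hframe c)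
    exact h1.comp 0 hγNd
  have hud := g.hasDerivAt_val_apply_along hcompatM (γ := fun t ↦ f (γN t))
    (V := fun t ↦ Gφ (f (γN t)))
    (W := fun t ↦ mfderiv I' I f (γN t) (e'.localFrame b' c (γN t))) hGlift hVlift
  -- the same derivative as an `mvfderiv` along the line
  have hFc : MDifferentiableAt I' 𝓘(ℝ, ℝ) (fun y ↦ g.val (f y) (Gφ (f y))
      (mfderiv I' I f y (e'.localFrame b' c y))) y₀ := by
    have h1 : MDifferentiableAt I' 𝓘(ℝ, ℝ)
        (fun y ↦ mvfderiv I' (fun y ↦ φ (f y)) y (e'.localFrame b' c y)) y₀ :=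
      (contMDiffAt_mvfderiv_localFrame b' hy₀ hφf2 c).mdifferentiableAt one_ne_zero
    rw [hfunc] at h1
    exact h1
  have hud' := hasDerivAt_comp_curve (γ := γN) (t := 0) (f := fun y ↦ g.val (f y) (Gφ (f y))
      (mfderiv I' I f y (e'.localFrame b' c y))) (by rw [hγN0]; exact hFc) hγNd
  rw [hvelN] at hud'
  have hderiv_eq := hud.unique hud'
  -- `hderiv_eq : g(D(Gφ∘f∘γ), df ∂_c) + g(Gφ, D(df ∂_c ∘ γ)) = mvfderiv (F_c) (γN 0) (∂ₐ y₀)`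
  -- (4) the first term: `Hess φ(df ∂ₐ, df ∂_c)`
  have hT1 : g.val (f (γN 0)) (covariantDerivAlong g.leviCivita (fun t ↦ f (γN t))
      (fun t ↦ Gφ (f (γN t))) 0) (mfderiv I' I f (γN 0) (e'.localFrame b' c (γN 0))) =
      g.hessian φ (f y₀) (mfderiv I' I f y₀ (e'.localFrame b' a y₀))
        (mfderiv I' I f y₀ (e'.localFrame b' c y₀)) := by
    have hcomp := covariantDerivAlong_comp_holds g.leviCivita (γ := fun t ↦ f (γN t))
      (Y := Gφ) (t₀ := 0) ((hfd (γN 0)).comp 0 hγNd)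
      (g.mdifferentiableAt_sharp_mvfderiv (hφ (f (γN 0))))
    have hvelM : velocity I (fun t ↦ f (γN t)) 0 = mfderiv I' I f (γN 0) (velocity I' γN 0) :=
      velocity_comp (hfd (γN 0)) hγNd
    rw [hcomp, hvelM, hvelN]
    have key : ∀ z, y₀ = z → g.val (f z) (g.leviCivita Gφ (f z) (mfderiv I' I f z
        (e'.localFrame b' a y₀))) (mfderiv I' I f z (e'.localFrame b' c z)) =
        g.hessian φ (f y₀) (mfderiv I' I f y₀ (e'.localFrame b' a y₀))
          (mfderiv I' I f y₀ (e'.localFrame b' c y₀)) := by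
      rintro z rfl
      exact g.val_leviCivita_grad_eq_hessian (hφ (f y₀)) _ _
    exact key _ hγN0.symm
  -- (5) the second term: tangent–normal decomposition
  have hnormal := val_covariantDerivAlong_mfderiv_localFrame_normal₀ g b' hf2 hν
    hun.isNormalTo hℓ0t hℓaff c
  have htang := fun w ↦ val_covariantDerivAlong_mfderiv_localFrame_symm_comp₀ g hpb hfi b' hℓ0t
    hℓaff c w
  -- tangential part of `grad φ`
  have hA : ∀ w : TangentSpace I' ((extChartAt I' y₀).symm (ℓ 0)),
      g.val (f ((extChartAt I' y₀).symm (ℓ 0))) (Gφ (f ((extChartAt I' y₀).symm (ℓ 0))))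
        (mfderiv I' I f ((extChartAt I' y₀).symm (ℓ 0)) w) =
      (g.inducedMetric f hpb hfi).val ((extChartAt I' y₀).symm (ℓ 0))
        ((g.inducedMetric f hpb hfi).sharp ((extChartAt I' y₀).symm (ℓ 0))
          (mvfderiv I' (fun y ↦ φ (f y)) ((extChartAt I' y₀).symm (ℓ 0))).toLinearMap) w := by
    intro w
    rw [val_sharp_apply, val_sharp_apply]
    exact (hchain _ w).symm
  have hdecomp := val_eq_inducedMetric_add_normal g hpb hfi
    (y := (extChartAt I' y₀).symm (ℓ 0)) (νy := ν ((extChartAt I' y₀).symm (ℓ 0)))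
    (A := Gφ (f ((extChartAt I' y₀).symm (ℓ 0))))
    (B := covariantDerivAlong g.leviCivita (fun t : ℝ ↦ f ((extChartAt I' y₀).symm (ℓ t)))
      (fun t ↦ mfderiv I' I f ((extChartAt I' y₀).symm (ℓ t))
        (e'.localFrame b' c ((extChartAt I' y₀).symm (ℓ t)))) 0)
    (ε := ε) (fun w ↦ hun.isNormalTo _ w) (hun.val_self _) hε hdim hA htang
  -- the pieces at the base point `Q = φ⁻¹(ℓ 0)`, in syntactically uniform form
  have hnormal' : g.val (f ((extChartAt I' y₀).symm (ℓ 0)))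
      (covariantDerivAlong g.leviCivita (fun t : ℝ ↦ f ((extChartAt I' y₀).symm (ℓ t)))
        (fun t ↦ mfderiv I' I f ((extChartAt I' y₀).symm (ℓ t))
          (e'.localFrame b' c ((extChartAt I' y₀).symm (ℓ t)))) 0)
      (ν ((extChartAt I' y₀).symm (ℓ 0))) =
      -(g.secondFundamentalForm I' f ν ((extChartAt I' y₀).symm (ℓ 0))
        (e'.localFrame b' a ((extChartAt I' y₀).symm (ℓ 0)))
        (e'.localFrame b' c ((extChartAt I' y₀).symm (ℓ 0)))) := hnormal
  have hGν : g.val (f ((extChartAt I' y₀).symm (ℓ 0))) (Gφ (f ((extChartAt I' y₀).symm (ℓ 0))))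
      (ν ((extChartAt I' y₀).symm (ℓ 0))) = mvfderiv I φ (f ((extChartAt I' y₀).symm (ℓ 0)))
        (ν ((extChartAt I' y₀).symm (ℓ 0))) := by
    rw [hGφ, val_sharp_apply]; rfl
  have hNcov' : covariantDerivAlong (g.inducedMetric f hpb hfi).leviCivita
      (fun t : ℝ ↦ (extChartAt I' y₀).symm (ℓ t))
      (fun t ↦ (trivializationAt E' (TangentSpace I') y₀).localFrame b' c
        ((extChartAt I' y₀).symm (ℓ t))) 0 =
      gN.leviCivita (e'.localFrame b' c) ((extChartAt I' y₀).symm (ℓ 0))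
        (e'.localFrame b' a ((extChartAt I' y₀).symm (ℓ 0))) := by
    rw [covariantDerivAlong_localFrame_symm_comp₀ b' gN.leviCivita hℓ0t hℓ c, sum_coord_basis_smul]
  have e3 : ∀ z, (extChartAt I' y₀).symm (ℓ 0) = z →
      g.val (f ((extChartAt I' y₀).symm (ℓ 0))) (Gφ (f ((extChartAt I' y₀).symm (ℓ 0))))
        (covariantDerivAlong g.leviCivita (fun t : ℝ ↦ f ((extChartAt I' y₀).symm (ℓ t)))
          (fun t ↦ mfderiv I' I f ((extChartAt I' y₀).symm (ℓ t))
            (e'.localFrame b' c ((extChartAt I' y₀).symm (ℓ t)))) 0) =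
      mvfderiv I' (fun y ↦ φ (f y)) z (gN.leviCivita (e'.localFrame b' c) z
          (e'.localFrame b' a z)) +
        mvfderiv I φ (f z) (ν z) *
          (-(g.secondFundamentalForm I' f ν z (e'.localFrame b' a z) (e'.localFrame b' c z))) /
            ε := by
    rintro z rfl
    rw [hdecomp, hnormal', hGν, hNcov', val_sharp_apply]
    rfl
  have hT2' : g.val (f (γN 0)) (Gφ (f (γN 0))) (covariantDerivAlong g.leviCivita
      (fun t ↦ f (γN t)) (fun t ↦ mfderiv I' I f (γN t) (e'.localFrame b' c (γN t))) 0) =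
      mvfderiv I' (fun y ↦ φ (f y)) y₀ (gN.leviCivita (e'.localFrame b' c) y₀
          (e'.localFrame b' a y₀)) +
        mvfderiv I φ (f y₀) (ν y₀) *
          (-(g.secondFundamentalForm I' f ν y₀ (e'.localFrame b' a y₀) (e'.localFrame b' c y₀))) /
            ε := e3 y₀ hQ
  -- the left-hand side of the goal, through `hderiv_eq`
  have key : ∀ z, γN 0 = z →
      mvfderiv I' (fun y ↦ g.val (f y) (Gφ (f y)) (mfderiv I' I f y (e'.localFrame b' c y))) z
        (e'.localFrame b' a y₀) =
      g.val (f (γN 0)) (covariantDerivAlong g.leviCivita (fun t ↦ f (γN t))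
        (fun t ↦ Gφ (f (γN t))) 0) (mfderiv I' I f (γN 0) (e'.localFrame b' c (γN 0))) +
      g.val (f (γN 0)) (Gφ (f (γN 0))) (covariantDerivAlong g.leviCivita (fun t ↦ f (γN t))
        (fun t ↦ mfderiv I' I f (γN t) (e'.localFrame b' c (γN t))) 0) := by
    rintro z rfl
    exact hderiv_eq.symm
  rw [key y₀ hγN0, hT1, hT2']
  field_simp
  ring


/-- **The Hessian of a restricted function**: for all `v, w ∈ T_{y₀} N`,
`Hess_{f^*g}(φ ∘ f)(v, w) = Hess_g φ(df v, df w) − (dφ(ν)/ε) K(v, w)` (both sides are bilinear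
and agree on the coordinate frame at `y₀`, `hessian_comp_apply_localFrame`). O'Neill 1983, Ch. 4,
Lemma 3 and Lemma 4; Schoen–Yau 1979, §2, (2.4)–(2.5). [cite: ONeill1983, Ch. 4, Lemma 3 and Lemma 4] -/
theorem hessian_comp_apply
    (hν : ContMDiff I' I.tangent ∞ (fun x ↦ (TotalSpace.mk' E (f x) (ν x) : TangentBundle I M)))
    (hun : g.IsUnitNormal I' f ν ε) (hε : ε ≠ 0)
    (hdim : Module.finrank ℝ E = Module.finrank ℝ E' + 1)
    {φ : M → ℝ} (hφ : CMDiff 2 φ) (y₀ : N) (v w : TangentSpace I' y₀) :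
    haveI := (g.inducedMetric f hpb hfi).hasLeviCivita
    (g.inducedMetric f hpb hfi).hessian (fun y ↦ φ (f y)) y₀ v w =
      g.hessian φ (f y₀) (mfderiv I' I f y₀ v) (mfderiv I' I f y₀ w) -
        mvfderiv I φ (f y₀) (ν y₀) / ε * g.secondFundamentalForm I' f ν y₀ v w := by
  classical
  haveI := (g.inducedMetric f hpb hfi).hasLeviCivita
  set bE := Module.finBasis ℝ E' with hbE
  -- the two bilinear forms
  set B₁ : LinearMap.BilinForm ℝ (TangentSpace I' y₀) :=
    (g.inducedMetric f hpb hfi).hessian (fun y ↦ φ (f y)) y₀ with hB₁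
  set B₂ : LinearMap.BilinForm ℝ (TangentSpace I' y₀) :=
    (g.hessian φ (f y₀)).comp (mfderiv I' I f y₀).toLinearMap (mfderiv I' I f y₀).toLinearMap -
      (mvfderiv I φ (f y₀) (ν y₀) / ε) • g.secondFundamentalForm I' f ν y₀ with hB₂
  have hb : ∀ i, (trivializationAt E' (TangentSpace I') y₀).localFrame bE i y₀ = bE i :=
    fun i ↦ localFrame_trivializationAt_self bE y₀ i
  have heq : B₁ = B₂ := by
    refine LinearMap.BilinForm.ext_basis (b := (bE : Module.Basis _ ℝ (TangentSpace I' y₀)))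
      fun i j ↦ ?_
    have h1 := g.hessian_comp_apply_localFrame hpb hfi bE (y₀ := y₀) hν hun hε hdim hφ i j
    rw [hb i, hb j] at h1
    simp only [hB₁, hB₂, LinearMap.BilinForm.sub_apply, LinearMap.smul_apply,
      LinearMap.BilinForm.comp_apply, ContinuousLinearMap.coe_coe, smul_eq_mul]
    exact h1
  have h := congrArg (fun B : LinearMap.BilinForm ℝ (TangentSpace I' y₀) ↦ B v w) heq
  simp only [hB₁, hB₂, LinearMap.BilinForm.sub_apply, LinearMap.smul_apply,
    LinearMap.BilinForm.comp_apply, ContinuousLinearMap.coe_coe, smul_eq_mul] at h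
  exact h

/-- **The Laplacian of a restricted function**:
`Δ_{f^*g}(φ ∘ f)(y₀) = tr_{f^*g} (Hess_g φ ∘ (df × df))(y₀) − (dφ(ν)/ε) H(y₀)`, the trace of
`hessian_comp_apply` (`H = tr_{f^*g} K` the mean curvature). For a minimal (`H = 0`) surface in a
region where the ambient Hessian of `φ` is positive on tangent `2`-planes, `φ ∘ f` is therefore
subharmonic — the maximum-principle argument of Schoen–Yau 1979, §2, Step 2, (2.4) (`φ = |y|²`) and
(2.5)–(2.7) (`φ = x³`). O'Neill 1983, Ch. 4, Lemma 3 and Lemma 4 with Ch. 3, Def. 3.50.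
[cite: SchoenYauPMT1979, §2, Step 2, (2.4)–(2.5)] -/
theorem dalembertian_comp_eq
    (hν : ContMDiff I' I.tangent ∞ (fun x ↦ (TotalSpace.mk' E (f x) (ν x) : TangentBundle I M)))
    (hun : g.IsUnitNormal I' f ν ε) (hε : ε ≠ 0)
    (hdim : Module.finrank ℝ E = Module.finrank ℝ E' + 1)
    {φ : M → ℝ} (hφ : CMDiff 2 φ) (y₀ : N) :
    haveI := (g.inducedMetric f hpb hfi).hasLeviCivita
    (g.inducedMetric f hpb hfi).dalembertian (fun y ↦ φ (f y)) y₀ =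
      (g.inducedMetric f hpb hfi).trace y₀
          ((g.hessian φ (f y₀)).comp (mfderiv I' I f y₀).toLinearMap
            (mfderiv I' I f y₀).toLinearMap) -
        mvfderiv I φ (f y₀) (ν y₀) / ε * g.meanCurvature f hpb hfi ν y₀ := by
  haveI := (g.inducedMetric f hpb hfi).hasLeviCivita
  have heq : (g.inducedMetric f hpb hfi).hessian (fun y ↦ φ (f y)) y₀ =
      (g.hessian φ (f y₀)).comp (mfderiv I' I f y₀).toLinearMap (mfderiv I' I f y₀).toLinearMap -
        (mvfderiv I φ (f y₀) (ν y₀) / ε) • g.secondFundamentalForm I' f ν y₀ := by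
    refine LinearMap.ext fun v ↦ LinearMap.ext fun w ↦ ?_
    rw [g.hessian_comp_apply hpb hfi hν hun hε hdim hφ y₀ v w]
    simp only [LinearMap.BilinForm.sub_apply, LinearMap.smul_apply,
      LinearMap.BilinForm.comp_apply, ContinuousLinearMap.coe_coe, smul_eq_mul]
  rw [dalembertian, heq, trace_sub, trace_smul, meanCurvature]

end Restricted

end PseudoRiemannianMetric

end Literature.Geometry.Lorentzian

end
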